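import Summits.MatrixMultiplication.OmegaCensus.SmallFormats.MatMul22nRankGF7PatternDFS
import HarnessLib

/-!
# ω-census family (a): splitting the normalised pattern search into subtrees (memory-bounded kernel replay)

Cell `pub-omega` (unit `pub-omega-tensor-g15`), topic `Summits/MatrixMultiplication/OmegaCensus` (sub-folder `SmallFormats`).
Framing (verbatim): lottery ticket; floor = certified bounds/negative ranges. HONEST FRAMING: kernel infrastructure (step P1 of
`pub-omega-tensor-g15/KERNEL-S4-DESIGN.md`), no mathematics beyond `MatMul22nRankGF7PatternDFS`; nothing here is progress on `ω`.

The one-piece search `dfs7` exceeds the kernel's memory bound at slack `4` (144 602 nodes with list membership at the leaves). This file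
provides (i) `dfs7m`, the same search with an arbitrary membership TEST `mem : ℕ → Bool` at the leaves (soundness `dfs7m_sound`, re-using
`mem_cands7`), (ii) `reach7`, the list of partial packings reached at depth `D` (soundness `reach7_sound`: the depth-`D` packing of every
normalised pattern is reached), and (iii) `cover7_sound`: if every reached depth-`D` state passes `dfs7m` (checked part by part in sibling
data files) then every normalised pattern passes the membership test.
-/

namespace Summit.MatrixMultiplication.OmegaCensus.SmallFormats

open Finset

/-- The search of `dfs7` with a membership test `mem` at complete assignments. -/
def dfs7m (s : ℕ) (mem : ℕ → Bool) : ℕ → ℕ → ℕ → Bool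
  | 0, _, _ => false
  | fuel + 1, k, A => if 42 ≤ k then mem A else
      (cands7 s A k).all fun v => dfs7m s mem fuel (k + 1) (A + (v + 1) * 2 ^ (3 * ord7 k))

/-- **Soundness of `dfs7m`.** -/
theorem dfs7m_sound {s : ℕ} (hs : s ≤ 6) {mem : ℕ → Bool} {P : ℕ → ℕ} (hP : IsPat7 s P) (hN : IsNorm7 P) :
    ∀ fuel k, k ≤ 42 → dfs7m s mem fuel k (Apack7 P k) = true → mem (packP7 P) = true := by
  intro fuel
  induction fuel with
  | zero => intro k _ h; simp [dfs7m] at h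
  | succ fuel ih =>
    intro k hk h
    unfold dfs7m at h
    by_cases h42 : 42 ≤ k
    · rw [if_pos h42] at h
      have hk42 : k = 42 := by omega
      subst hk42
      exact h
    · rw [if_neg h42] at h
      have hmem := mem_cands7 hs hP hN (k := k) (by omega)
      have h' := List.all_eq_true.1 h _ hmem
      rw [← Apack7_succ] at h'
      exact ih (k + 1) (by omega) h'

/-- The partial packings reached at depth `D` from `(k, A)`. -/
def reach7 (s D : ℕ) : ℕ → ℕ → ℕ → List ℕ
  | 0, _, _ => []
  | fuel + 1, k, A => if D ≤ k then [A] else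
      (cands7 s A k).flatMap fun v => reach7 s D fuel (k + 1) (A + (v + 1) * 2 ^ (3 * ord7 k))

/-- **Soundness of `reach7`.** The depth-`D` packing of a normalised pattern is reached from each of its shallower packings. -/
theorem reach7_sound {s : ℕ} (hs : s ≤ 6) {D : ℕ} (hD : D ≤ 42) {P : ℕ → ℕ} (hP : IsPat7 s P) (hN : IsNorm7 P) :
    ∀ fuel k, k ≤ D → D - k < fuel → Apack7 P D ∈ reach7 s D fuel k (Apack7 P k) := by
  intro fuel
  induction fuel with
  | zero => intro k _ h; omega
  | succ fuel ih =>
    intro k hk hf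
    unfold reach7
    by_cases hDk : D ≤ k
    · rw [if_pos hDk]
      have : k = D := by omega
      subst this; simp
    · rw [if_neg hDk, List.mem_flatMap]
      refine ⟨P (ord7 k), mem_cands7 hs hP hN (k := k) (by omega), ?_⟩
      rw [← Apack7_succ]
      exact ih (k + 1) (by omega) (by omega)

/-- **Covering lemma.** If every depth-`D` state reached from the empty assignment passes `dfs7m`, every normalised pattern of slack
`s ≤ 6` passes the membership test. -/
theorem cover7_sound {s : ℕ} (hs : s ≤ 6) {D : ℕ} (hD : D ≤ 42) {mem : ℕ → Bool} {fuel₁ fuel₂ : ℕ} (hf : D < fuel₁)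
    (hall : ∀ A ∈ reach7 s D fuel₁ 0 0, dfs7m s mem fuel₂ D A = true) {P : ℕ → ℕ} (hP : IsPat7 s P) (hN : IsNorm7 P) :
    mem (packP7 P) = true := by
  have h0 : Apack7 P 0 = 0 := by unfold Apack7; simp
  have hr := reach7_sound hs hD hP hN fuel₁ 0 (Nat.zero_le _) (by omega)
  rw [h0] at hr
  exact dfs7m_sound hs hP hN fuel₂ D hD (hall _ hr)

/-- The points of `Ω` are all assigned: `ord7` has an inverse table on `[0, 42)` (`6`-bit fields). -/
def ordInv7 (z : ℕ) : ℕ := fld 6 4707587733914276843962138331798069646713310383915981212864593520241415583425 z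

set_option maxRecDepth 100000 in
/-- `ord7 ∘ ordInv7 = id` on `[0, 42)`. -/
theorem ordInv7_ok : ∀ z : Fin 42, ordInv7 z.val < 42 ∧ ord7 (ordInv7 z.val) = z.val := by decide

/-- **Reading a pattern off its packing.** For a pattern of slack `s ≤ 6`: `fld 3 (packP7 P) z = P z + 1` (`z < 42`). -/
theorem fld_packP7 {s : ℕ} (hs : s ≤ 6) {P : ℕ → ℕ} (hP : ∀ z < 42, P z ≤ s) {z : ℕ} (hz : z < 42) :
    fld 3 (packP7 P) z = P z + 1 := by
  obtain ⟨hi, he⟩ := ordInv7_ok ⟨z, hz⟩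
  have hd := dg7_Apack7 hs hP (le_refl 42) hi
  rw [if_pos hi] at hd
  unfold dg7 at hd
  have he' : ord7 (ordInv7 z) = z := he
  rw [he'] at hd
  exact hd

end Summit.MatrixMultiplication.OmegaCensus.SmallFormats
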